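import Literature.Probability.LatticeModels.InversionPositivity
import Literature.MathematicalPhysics.QuantumFieldTheory.PointwiseOSReconstruction
import HarnessLib

/-!
# Mack's converse, pointwise form: Möbius covariance + Osterwalder–Schrader positivity ⇒
# inversion (radial OS) positivity

Route `PerfectScreening`, sub-problem `Ising3DConformalLimit`, line `Sketch` of crux
`MoebiusLimitExists` (stmt-CriticalPhenomena-1344; lead `prover-line-stmt-CriticalPhenomena-1344-c12-0`).
Model-independent, any dimension `d`; companion file
`PerfectScreeningMoebiusLimitExistsInversionPositive.lean` draws the consequences for the critical
`ℤ³` Ising limit (item stmt-4671 ⟺ item stmt-1982; crux stmt-1344 ⟺ stmt-1981 ∧ stmt-4671).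

THEOREM (`isInversionPositive_of_covariant_of_reflectionPositive`, registered anchor).  For a
correlation family `S : CorrFamily d` that is translation invariant, scale covariant and inversion
covariant with weight `Δ`, permutation symmetric, and reflection invariant and reflection positive
along one coordinate axis `τ` (the pointwise OS premises of
`Literature.MathematicalPhysics.QuantumFieldTheory.PointwiseOSReconstruction`), `S` is INVERSION
POSITIVE with weight `Δ` (`Literature.Probability.LatticeModels.IsInversionPositive`): every radial
OS Gram matrix `M_{ab} = (∏ᵢ ‖X_b i‖^{-2Δ}) S(X_a ⊔ ιX_b)` over an admissible family of configurations
in the punctured unit ball is positive semidefinite.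

MECHANISM.  The Cayley-type Möbius map `J` = inversion in the sphere of radius `√2` about the pole
`p = -e_τ` maps the unit ball onto the half-space `{x_τ > 0}` (`cayley_apply_self_pos`) and
conjugates the unit inversion `ι` to the reflection `θ_τ` (`cayley_unitInversion`);
`J = T_p ∘ D_2 ∘ ι ∘ T_{-p}` is a word in the Möbius generators, so
`S(J v) = 2^{-nΔ} ∏‖vᵢ - p‖^{2Δ} S(v)` (`corr_cayley`); the conformal weights then FACTORISE the
radial Gram matrix through the planar OS kernel, `M_{ab} = γ_a γ_b K_S(J X_b, J X_a)`
(`inversionGram_eq_weight_mul_osPointKernel`; the per-point identity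
`‖x‖^{-2Δ}‖θJx - p‖^{2Δ} = ‖Jx - p‖^{2Δ}` is `weight_identity`), i.e. `M` is a positive diagonal
congruence of an OS matrix.  (Lüscher–Mack, Comm. Math. Phys. 41 (1975); Mack 1975: OS positivity
in radial quantisation of a Euclidean conformal theory; Neeb–Ólafsson, J. Funct. Anal. 266 (2014)
§6 for the ball/half-space picture.  The tree held only the opposite direction, item stmt-4674
`positivityImpliesInversionCovariance_proof`.)

No `sorry`, no definitions, no notation: the pole is `-(EuclideanSpace.single τ 1)`, the Cayley map is
`EuclideanGeometry.inversion (-(EuclideanSpace.single τ 1)) (Real.sqrt 2)` throughout.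
-/

noncomputable section

open EuclideanGeometry Filter Topology Finset
open Literature.Probability.LatticeModels Literature.MathematicalPhysics.QuantumFieldTheory
open scoped RealInnerProductSpace

namespace Summit.CriticalPhenomena.Ising3DConformalLimit.MoebiusLimitExistsMackConverse

variable {d : ℕ}

/-! ## Part 1. The pole, the Cayley map, and Mack's converse -/

/-- Coordinates of the pole `p = -e_τ`. [folklore] -/
theorem pole_apply (τ i : Fin d) : ((-(EuclideanSpace.single τ (1 : ℝ))) : EuclideanSpace ℝ (Fin d)) i = if i = τ then -1 else 0 := by
  simp only [PiLp.neg_apply, PiLp.single_apply]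
  split_ifs <;> simp

/-- `‖p‖ = 1`. [folklore] -/
theorem norm_pole (τ : Fin d) : ‖((-(EuclideanSpace.single τ (1 : ℝ))) : EuclideanSpace ℝ (Fin d))‖ = 1 := by
  simp

/-- `⟪x, p⟫ = -x_τ`. [folklore] -/
theorem inner_pole (τ : Fin d) (x : EuclideanSpace ℝ (Fin d)) : ⟪x, (-(EuclideanSpace.single τ (1 : ℝ)))⟫ = -x τ := by
  simp [inner_neg_right, EuclideanSpace.inner_single_right]

/-- `‖x - p‖² = ‖x‖² + 2 x_τ + 1`. [folklore] -/
theorem norm_sub_pole_sq (τ : Fin d) (x : EuclideanSpace ℝ (Fin d)) :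
    ‖x - (-(EuclideanSpace.single τ (1 : ℝ)))‖ ^ 2 = ‖x‖ ^ 2 + 2 * x τ + 1 := by
  rw [norm_sub_sq_real, inner_pole, norm_pole]; ring

/-- A point of the open unit ball is not the pole. [folklore] -/
theorem ne_pole_of_norm_lt_one (τ : Fin d) {x : EuclideanSpace ℝ (Fin d)} (hx : ‖x‖ < 1) :
    x ≠ (-(EuclideanSpace.single τ (1 : ℝ))) := by
  rintro rfl; simp at hx

/-- A point outside the closed unit ball is not the pole. [folklore] -/
theorem ne_pole_of_one_lt_norm (τ : Fin d) {x : EuclideanSpace ℝ (Fin d)} (hx : 1 < ‖x‖) :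
    x ≠ (-(EuclideanSpace.single τ (1 : ℝ))) := by
  rintro rfl; simp at hx

/-- The axis reflection as the reflection along the pole: `θ_τ x = x - 2⟪x,p⟫ p`. [folklore] -/
theorem axisReflection_eq_sub_pole (τ : Fin d) (x : EuclideanSpace ℝ (Fin d)) :
    axisReflection τ x = x - (2 * ⟪x, (-(EuclideanSpace.single τ (1 : ℝ)))⟫) • (-(EuclideanSpace.single τ (1 : ℝ))) := by
  ext i
  simp only [axisReflection_apply, inner_pole, PiLp.sub_apply, PiLp.smul_apply, pole_apply,
    smul_eq_mul]
  split_ifs with h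
  · subst h; ring
  · ring

/-- `θ_τ p = -p`. [folklore] -/
theorem axisReflection_pole (τ : Fin d) :
    axisReflection τ ((-(EuclideanSpace.single τ (1 : ℝ))) : EuclideanSpace ℝ (Fin d)) = -(-(EuclideanSpace.single τ (1 : ℝ))) := by
  rw [axisReflection_eq_sub_pole, real_inner_self_eq_norm_sq, norm_pole]
  simp only [one_pow, mul_one, two_smul]
  abel

/-- `J` is an involution. [folklore] -/
theorem cayley_cayley (τ : Fin d) (x : EuclideanSpace ℝ (Fin d)) : inversion (-(EuclideanSpace.single τ (1 : ℝ))) (Real.sqrt 2) (inversion (-(EuclideanSpace.single τ (1 : ℝ))) (Real.sqrt 2) x) = x :=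
  inversion_inversion _ (Real.sqrt_ne_zero'.2 two_pos) x

/-- `J` is injective. [folklore] -/
theorem cayley_injective (τ : Fin d) :
    Function.Injective (inversion (-(EuclideanSpace.single τ (1 : ℝ))) (Real.sqrt 2) : EuclideanSpace ℝ (Fin d) → EuclideanSpace ℝ (Fin d)) :=
  inversion_injective _ (Real.sqrt_ne_zero'.2 two_pos)

/-- Explicit formula: `J x = (2/‖x - p‖²) • (x - p) + p`. [folklore] -/
theorem cayley_eq (τ : Fin d) (x : EuclideanSpace ℝ (Fin d)) :
    inversion (-(EuclideanSpace.single τ (1 : ℝ))) (Real.sqrt 2) x = (2 / ‖x - (-(EuclideanSpace.single τ (1 : ℝ)))‖ ^ 2) • (x - (-(EuclideanSpace.single τ (1 : ℝ)))) + (-(EuclideanSpace.single τ (1 : ℝ))) := by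
  rw [inversion, dist_eq_norm, vsub_eq_sub, vadd_eq_add, div_pow, Real.sq_sqrt zero_le_two]

/-- `J x = 2 • ι (x - p) + p` with `ι` the unit inversion at the origin: `J` is a word in the
Möbius generators (translate, invert, dilate, translate). [folklore] -/
theorem cayley_eq_generators (τ : Fin d) (x : EuclideanSpace ℝ (Fin d)) :
    inversion (-(EuclideanSpace.single τ (1 : ℝ))) (Real.sqrt 2) x = (2 : ℝ) • inversion (0 : EuclideanSpace ℝ (Fin d)) 1 (x - (-(EuclideanSpace.single τ (1 : ℝ)))) + (-(EuclideanSpace.single τ (1 : ℝ))) := by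
  rw [cayley_eq, inversion, dist_eq_norm, vsub_eq_sub, sub_zero, vadd_eq_add, add_zero, smul_smul]
  congr 2
  rw [div_pow, one_pow, one_div, div_eq_mul_inv]

/-- `‖J x - p‖ = 2/‖x - p‖`. [folklore] -/
theorem norm_cayley_sub_pole (τ : Fin d) (x : EuclideanSpace ℝ (Fin d)) :
    ‖inversion (-(EuclideanSpace.single τ (1 : ℝ))) (Real.sqrt 2) x - (-(EuclideanSpace.single τ (1 : ℝ)))‖ = 2 / ‖x - (-(EuclideanSpace.single τ (1 : ℝ)))‖ := by
  have h := dist_inversion_center ((-(EuclideanSpace.single τ (1 : ℝ))) : EuclideanSpace ℝ (Fin d)) x (Real.sqrt 2)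
  rwa [dist_eq_norm, dist_eq_norm, Real.sq_sqrt zero_le_two] at h

/-- `J x ≠ p` for `x ≠ p`. [folklore] -/
theorem cayley_ne_pole (τ : Fin d) {x : EuclideanSpace ℝ (Fin d)} (hx : x ≠ (-(EuclideanSpace.single τ (1 : ℝ)))) :
    inversion (-(EuclideanSpace.single τ (1 : ℝ))) (Real.sqrt 2) x ≠ (-(EuclideanSpace.single τ (1 : ℝ))) := by
  rw [Ne, inversion_eq_center (Real.sqrt_ne_zero'.2 two_pos)]
  exact hx

/-- The `τ`-coordinate of `J x`: `(J x)_τ = 2 (x_τ + 1)/‖x - p‖² - 1`. [folklore] -/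
theorem cayley_apply_self (τ : Fin d) (x : EuclideanSpace ℝ (Fin d)) :
    inversion (-(EuclideanSpace.single τ (1 : ℝ))) (Real.sqrt 2) x τ = 2 * (x τ + 1) / ‖x - (-(EuclideanSpace.single τ (1 : ℝ)))‖ ^ 2 - 1 := by
  rw [cayley_eq]
  simp only [PiLp.add_apply, PiLp.smul_apply, PiLp.sub_apply, pole_apply, if_true, smul_eq_mul]
  ring

/-- **`J` maps the open unit ball into the half-space `{x_τ > 0}`.** [folklore] -/
theorem cayley_apply_self_pos (τ : Fin d) {x : EuclideanSpace ℝ (Fin d)} (hx : ‖x‖ < 1) :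
    0 < inversion (-(EuclideanSpace.single τ (1 : ℝ))) (Real.sqrt 2) x τ := by
  have hD : 0 < ‖x - (-(EuclideanSpace.single τ (1 : ℝ)))‖ ^ 2 := by
    have : x - (-(EuclideanSpace.single τ (1 : ℝ))) ≠ 0 := sub_ne_zero.2 (ne_pole_of_norm_lt_one τ hx)
    positivity
  rw [cayley_apply_self, sub_pos, lt_div_iff₀ hD, one_mul, norm_sub_pole_sq]
  have : ‖x‖ ^ 2 < 1 := by
    have h0 : 0 ≤ ‖x‖ := norm_nonneg _
    nlinarith
  linarith

/-- The unit inversion at the origin is `x ↦ ‖x‖⁻² • x`. [folklore] -/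
theorem unitInversion_eq (x : EuclideanSpace ℝ (Fin d)) : inversion (0 : EuclideanSpace ℝ (Fin d)) 1 x = (‖x‖ ^ 2)⁻¹ • x := by
  rw [inversion, dist_eq_norm, vsub_eq_sub, sub_zero, vadd_eq_add, add_zero, div_pow, one_pow,
    one_div]

/-- The unit inversion fixes the pole (it lies on the unit sphere). [folklore] -/
theorem unitInversion_pole (τ : Fin d) : inversion (0 : EuclideanSpace ℝ (Fin d)) 1 ((-(EuclideanSpace.single τ (1 : ℝ))) : EuclideanSpace ℝ (Fin d)) = (-(EuclideanSpace.single τ (1 : ℝ))) := by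
  rw [unitInversion_eq, norm_pole, one_pow, inv_one, one_smul]

/-- `‖ι x - p‖ = ‖x - p‖/‖x‖` for `x ≠ 0`. [folklore] -/
theorem norm_unitInversion_sub_pole (τ : Fin d) {x : EuclideanSpace ℝ (Fin d)} (hx : x ≠ 0) :
    ‖inversion (0 : EuclideanSpace ℝ (Fin d)) 1 x - (-(EuclideanSpace.single τ (1 : ℝ)))‖ = ‖x - (-(EuclideanSpace.single τ (1 : ℝ)))‖ / ‖x‖ := by
  have hp : ((-(EuclideanSpace.single τ (1 : ℝ))) : EuclideanSpace ℝ (Fin d)) ≠ 0 := by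
    intro h; have := norm_pole τ; rw [h, norm_zero] at this; exact zero_ne_one this
  have h := dist_inversion_inversion hx hp (1 : ℝ)
  rw [unitInversion_pole, dist_eq_norm, dist_eq_norm, dist_eq_norm, dist_eq_norm, sub_zero,
    sub_zero, norm_pole, mul_one, one_pow] at h
  rw [h, div_mul_eq_mul_div, one_mul]

/-- `‖ι x - p‖² = ‖x - p‖²/‖x‖²` for `x ≠ 0`. [folklore] -/
theorem norm_unitInversion_sub_pole_sq (τ : Fin d) {x : EuclideanSpace ℝ (Fin d)} (hx : x ≠ 0) :
    ‖inversion (0 : EuclideanSpace ℝ (Fin d)) 1 x - (-(EuclideanSpace.single τ (1 : ℝ)))‖ ^ 2 = ‖x - (-(EuclideanSpace.single τ (1 : ℝ)))‖ ^ 2 / ‖x‖ ^ 2 := by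
  rw [norm_unitInversion_sub_pole τ hx, div_pow]

/-- **`J` conjugates the unit inversion to the axis reflection**: `J (ι x) = θ_τ (J x)` for
`x ≠ 0`, `x ≠ p`. [folklore] -/
theorem cayley_unitInversion (τ : Fin d) {x : EuclideanSpace ℝ (Fin d)} (hx : x ≠ 0)
    (hxp : x ≠ (-(EuclideanSpace.single τ (1 : ℝ)))) : inversion (-(EuclideanSpace.single τ (1 : ℝ))) (Real.sqrt 2) (inversion (0 : EuclideanSpace ℝ (Fin d)) 1 x) = axisReflection τ (inversion (-(EuclideanSpace.single τ (1 : ℝ))) (Real.sqrt 2) x) := by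
  have hs : ‖x‖ ^ 2 ≠ 0 := by positivity
  have hD : ‖x - (-(EuclideanSpace.single τ (1 : ℝ)))‖ ^ 2 ≠ 0 := by
    have : x - (-(EuclideanSpace.single τ (1 : ℝ))) ≠ 0 := sub_ne_zero.2 hxp
    positivity
  have hDeq := norm_sub_pole_sq τ x
  rw [cayley_eq, cayley_eq, norm_unitInversion_sub_pole_sq τ hx, unitInversion_eq,
    map_add, map_smul, map_sub, axisReflection_pole, axisReflection_eq_sub_pole, inner_pole]
  rw [hDeq] at hD ⊢
  match_scalars
  · field_simp
  · field_simp
    ring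

/-- **Covariance under the Cayley map.** For a translation-invariant, scale-covariant and
inversion-covariant family `S` (weight `Δ`) and a configuration avoiding the pole,
`S_n(J v₁, …, J vₙ) = 2^{-nΔ} (∏ᵢ ‖vᵢ - p‖^{2Δ}) S_n(v)` — the chain rule along the word
`J = T_p ∘ D_2 ∘ ι ∘ T_{-p}`. (Di Francesco–Mathieu–Sénéchal 1997, §4.3.1 eq. (4.62).)
[cite: FrancescoMathieuSenechal1997, §4.3.1 eq. (4.62)] -/
theorem corr_cayley {Δ : ℝ} {S : CorrFamily d} (τ : Fin d) (htr : IsTranslationInvariant S)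
    (hsc : IsScaleCovariant Δ S) (hinv : IsInversionCovariant Δ S) {n : ℕ}
    (v : Fin n → EuclideanSpace ℝ (Fin d)) (hv : ∀ i, v i ≠ (-(EuclideanSpace.single τ (1 : ℝ)))) :
    S n (fun i => inversion (-(EuclideanSpace.single τ (1 : ℝ))) (Real.sqrt 2) (v i)) =
      (2 : ℝ) ^ (-(n : ℝ) * Δ) * (∏ i, ‖v i - (-(EuclideanSpace.single τ (1 : ℝ)))‖ ^ (2 * Δ)) * S n v := by
  have e1 : (fun i => inversion (-(EuclideanSpace.single τ (1 : ℝ))) (Real.sqrt 2) (v i)) = fun i => (2 : ℝ) • inversion (0 : EuclideanSpace ℝ (Fin d)) 1 (v i - (-(EuclideanSpace.single τ (1 : ℝ)))) + (-(EuclideanSpace.single τ (1 : ℝ))) :=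
    funext fun i => cayley_eq_generators τ (v i)
  have h1 := htr n (-(EuclideanSpace.single τ (1 : ℝ))) (fun i => (2 : ℝ) • inversion (0 : EuclideanSpace ℝ (Fin d)) 1 (v i - (-(EuclideanSpace.single τ (1 : ℝ)))))
  have h2 := hsc n 2 two_pos (fun i => inversion (0 : EuclideanSpace ℝ (Fin d)) 1 (v i - (-(EuclideanSpace.single τ (1 : ℝ)))))
  have h3 := hinv n (fun i => v i - (-(EuclideanSpace.single τ (1 : ℝ)))) (fun i => sub_ne_zero.2 (hv i))
  have h4 := htr n (-(-(EuclideanSpace.single τ (1 : ℝ)))) v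
  simp only [← sub_eq_add_neg] at h4
  rw [e1, h1, h2, h3, h4]
  ring

/-- The per-point weight identity behind the factorisation:
`‖x‖^{-2Δ} ‖θ_τ (J x) - p‖^{2Δ} = ‖J x - p‖^{2Δ}` for `0 < ‖x‖ < 1`. [folklore] -/
theorem weight_identity (τ : Fin d) (Δ : ℝ) {x : EuclideanSpace ℝ (Fin d)} (hx : x ≠ 0)
    (hx1 : ‖x‖ < 1) :
    ‖x‖ ^ (-(2 * Δ)) * ‖axisReflection τ (inversion (-(EuclideanSpace.single τ (1 : ℝ))) (Real.sqrt 2) x) - (-(EuclideanSpace.single τ (1 : ℝ)))‖ ^ (2 * Δ) =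
      ‖inversion (-(EuclideanSpace.single τ (1 : ℝ))) (Real.sqrt 2) x - (-(EuclideanSpace.single τ (1 : ℝ)))‖ ^ (2 * Δ) := by
  have hxp : x ≠ (-(EuclideanSpace.single τ (1 : ℝ))) := ne_pole_of_norm_lt_one τ hx1
  have hn : 0 < ‖x‖ := norm_pos_iff.2 hx
  have hD : 0 < ‖x - (-(EuclideanSpace.single τ (1 : ℝ)))‖ := norm_pos_iff.2 (sub_ne_zero.2 hxp)
  rw [← cayley_unitInversion τ hx hxp, norm_cayley_sub_pole, norm_cayley_sub_pole,
    norm_unitInversion_sub_pole τ hx, div_div_eq_mul_div,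
    show 2 * ‖x‖ / ‖x - (-(EuclideanSpace.single τ (1 : ℝ)))‖ = ‖x‖ * (2 / ‖x - (-(EuclideanSpace.single τ (1 : ℝ)))‖) by ring,
    Real.mul_rpow hn.le (by positivity), ← mul_assoc, Real.rpow_neg hn.le, inv_mul_cancel₀
      (Real.rpow_pos_of_pos hn _).ne', one_mul]

/-- **Factorisation of the radial OS Gram matrix through the planar OS kernel.**  For an admissible
family `X` (injective configurations in the punctured open unit ball) and a family `S` that is
translation invariant, scale and inversion covariant (weight `Δ`) and permutation symmetric,
`(∏ᵢ ‖X_b i‖^{-2Δ}) S(X_a ⊔ ιX_b) = γ_a γ_b S(θ_τ J X_b ⊔ J X_a)` with the Cayley weights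
`γ_c = 2^{-k_c Δ} ∏ᵢ ‖J X_c i - p‖^{2Δ}`; the last factor is the OS kernel `K_S(J X_b, J X_a)` along
`τ` at two half-space configurations. [folklore] -/
theorem inversionGram_eq_weight_mul_osPointKernel {Δ : ℝ} {S : CorrFamily d} (τ : Fin d)
    (htr : IsTranslationInvariant S) (hsc : IsScaleCovariant Δ S) (hinv : IsInversionCovariant Δ S)
    (hperm : IsPermutationSymmetric S) {m : ℕ} {k : Fin m → ℕ}
    {X : (a : Fin m) → Fin (k a) → EuclideanSpace ℝ (Fin d)}
    (hX : ∀ a i, X a i ≠ 0 ∧ ‖X a i‖ < 1) (a b : Fin m) :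
    (∏ i, ‖X b i‖ ^ (-(2 * Δ))) *
        S (k a + k b) (Fin.append (X a) (fun i => inversion 0 1 (X b i))) =
      ((2 : ℝ) ^ (-(k a : ℝ) * Δ) * ∏ i, ‖inversion (-(EuclideanSpace.single τ (1 : ℝ))) (Real.sqrt 2) (X a i) - (-(EuclideanSpace.single τ (1 : ℝ)))‖ ^ (2 * Δ)) *
        ((2 : ℝ) ^ (-(k b : ℝ) * Δ) * ∏ i, ‖inversion (-(EuclideanSpace.single τ (1 : ℝ))) (Real.sqrt 2) (X b i) - (-(EuclideanSpace.single τ (1 : ℝ)))‖ ^ (2 * Δ)) *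
        S (k b + k a) (Fin.append (fun i => axisReflection τ (inversion (-(EuclideanSpace.single τ (1 : ℝ))) (Real.sqrt 2) (X b i))) (fun i => inversion (-(EuclideanSpace.single τ (1 : ℝ))) (Real.sqrt 2) (X a i))) := by
  -- the half-space picture `v = J X_a ⊔ θ J X_b`, with `J ∘ v = X_a ⊔ ι X_b`
  set v : Fin (k a + k b) → EuclideanSpace ℝ (Fin d) :=
    Fin.append (fun i => inversion (-(EuclideanSpace.single τ (1 : ℝ))) (Real.sqrt 2) (X a i)) (fun i => axisReflection τ (inversion (-(EuclideanSpace.single τ (1 : ℝ))) (Real.sqrt 2) (X b i))) with hv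
  have hxp : ∀ c i, X c i ≠ (-(EuclideanSpace.single τ (1 : ℝ))) := fun c i => ne_pole_of_norm_lt_one τ (hX c i).2
  have hJv : (fun i => inversion (-(EuclideanSpace.single τ (1 : ℝ))) (Real.sqrt 2) (v i)) = Fin.append (X a) (fun i => inversion 0 1 (X b i)) := by
    funext i
    refine Fin.addCases (fun j => ?_) (fun j => ?_) i
    · simp [hv]
    · simp only [hv, Fin.append_right]
      rw [← cayley_unitInversion τ (hX b j).1 (hxp b j), cayley_cayley]
  have hvp : ∀ i, v i ≠ (-(EuclideanSpace.single τ (1 : ℝ))) := by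
    intro i
    refine Fin.addCases (fun j => ?_) (fun j => ?_) i
    · simp only [hv, Fin.append_left]
      exact cayley_ne_pole τ (hxp a j)
    · simp only [hv, Fin.append_right]
      rw [← cayley_unitInversion τ (hX b j).1 (hxp b j)]
      exact cayley_ne_pole τ (ne_pole_of_one_lt_norm τ (one_lt_norm_inversion (hX b j).1 (hX b j).2))
  -- covariance under `J`
  rw [← hJv, corr_cayley τ htr hsc hinv v hvp]
  -- the kernel: block swap by permutation symmetry
  have hK : S (k a + k b) v =
      S (k b + k a) (Fin.append (fun i => axisReflection τ (inversion (-(EuclideanSpace.single τ (1 : ℝ))) (Real.sqrt 2) (X b i))) (fun i => inversion (-(EuclideanSpace.single τ (1 : ℝ))) (Real.sqrt 2) (X a i))) := by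
    rw [← hperm.comp_equiv (finBlockSwap (k b) (k a)), fin_append_comp_finBlockSwap]
  -- the weights: split the product over the two blocks and use the per-point identity
  have hprod : (∏ i, ‖v i - (-(EuclideanSpace.single τ (1 : ℝ)))‖ ^ (2 * Δ)) =
      (∏ i, ‖inversion (-(EuclideanSpace.single τ (1 : ℝ))) (Real.sqrt 2) (X a i) - (-(EuclideanSpace.single τ (1 : ℝ)))‖ ^ (2 * Δ)) *
        ∏ i, ‖axisReflection τ (inversion (-(EuclideanSpace.single τ (1 : ℝ))) (Real.sqrt 2) (X b i)) - (-(EuclideanSpace.single τ (1 : ℝ)))‖ ^ (2 * Δ) := by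
    rw [Fin.prod_univ_add]
    simp [hv]
  have hwb : (∏ i, ‖X b i‖ ^ (-(2 * Δ))) * ∏ i, ‖axisReflection τ (inversion (-(EuclideanSpace.single τ (1 : ℝ))) (Real.sqrt 2) (X b i)) - (-(EuclideanSpace.single τ (1 : ℝ)))‖ ^ (2 * Δ) =
      ∏ i, ‖inversion (-(EuclideanSpace.single τ (1 : ℝ))) (Real.sqrt 2) (X b i) - (-(EuclideanSpace.single τ (1 : ℝ)))‖ ^ (2 * Δ) := by
    rw [← Finset.prod_mul_distrib]
    exact Finset.prod_congr rfl fun i _ => weight_identity τ Δ (hX b i).1 (hX b i).2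
  have h2 : (2 : ℝ) ^ (-((k a + k b : ℕ) : ℝ) * Δ) =
      (2 : ℝ) ^ (-(k a : ℝ) * Δ) * (2 : ℝ) ^ (-(k b : ℝ) * Δ) := by
    rw [← Real.rpow_add two_pos]; push_cast; ring_nf
  rw [hK, hprod, h2, ← hwb]
  ring

/-- **Mack's converse, pointwise form: Möbius covariance and Osterwalder–Schrader positivity imply
inversion (radial OS) positivity.**  Let `S : CorrFamily d` be translation invariant, scale
covariant and inversion covariant with weight `Δ`, permutation symmetric, and reflection invariant
and reflection positive along a coordinate axis `τ`.  Then `S` is inversion positive with weight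
`Δ`: every radial OS Gram matrix `M_{ab} = (∏ᵢ ‖X_b i‖^{-2Δ}) S(X_a ⊔ ιX_b)` over an admissible
family in the punctured open unit ball is positive semidefinite.  Proof: by
`inversionGram_eq_weight_mul_osPointKernel`, `M_{ab} = γ_a γ_b K_S(J X_b, J X_a)` with the OS
kernel `K_S` along `τ` at the half-space configurations `J X_c` (`cayley_apply_self_pos`), so the
quadratic form of `M` at `c` is the OS form at the coefficients `c_a γ_a` (nonnegative by reflection
positivity) and `M` is symmetric because `K_S` is (`osPointKernel_comm`).  (Lüscher–Mack, Comm.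
Math. Phys. 41 (1975) and Mack 1975: OS positivity in radial quantisation of a Euclidean conformal
theory; Neeb–Ólafsson, J. Funct. Anal. 266 (2014), §6.2–6.3.) [cite: LuscherMack1975, §2–§3] -/
theorem isInversionPositive_of_covariant_of_reflectionPositive :
    ∀ {d : ℕ} (τ : Fin d) {Δ : ℝ} {S : Literature.Probability.LatticeModels.CorrFamily d},
      Literature.Probability.LatticeModels.IsTranslationInvariant S →
      Literature.Probability.LatticeModels.IsScaleCovariant Δ S →
      Literature.Probability.LatticeModels.IsInversionCovariant Δ S →
      Literature.MathematicalPhysics.QuantumFieldTheory.IsPermutationSymmetric S →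
      Literature.MathematicalPhysics.QuantumFieldTheory.IsReflectionInvariantAlong τ S →
      Literature.MathematicalPhysics.QuantumFieldTheory.IsReflectionPositiveAlong τ S →
      Literature.Probability.LatticeModels.IsInversionPositive Δ S := by
  intro d τ Δ S htr hsc hinv hperm hR hrp m k X hX hinj
  -- the half-space configurations `J X_c`
  let cfg : Fin m → HalfSpaceConfig d τ := fun c =>
    { n := k c
      pts := fun i => inversion (-(EuclideanSpace.single τ (1 : ℝ))) (Real.sqrt 2) (X c i)
      injective := (cayley_injective τ).comp (hinj c)
      pos := fun i => cayley_apply_self_pos τ (hX c i).2 }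
  have hfac : ∀ a b : Fin m, (∏ i, ‖X b i‖ ^ (-(2 * Δ))) *
        S (k a + k b) (Fin.append (X a) (fun i => inversion 0 1 (X b i))) =
      ((2 : ℝ) ^ (-(k a : ℝ) * Δ) * ∏ i, ‖inversion (-(EuclideanSpace.single τ (1 : ℝ))) (Real.sqrt 2) (X a i) - (-(EuclideanSpace.single τ (1 : ℝ)))‖ ^ (2 * Δ)) *
        ((2 : ℝ) ^ (-(k b : ℝ) * Δ) * ∏ i, ‖inversion (-(EuclideanSpace.single τ (1 : ℝ))) (Real.sqrt 2) (X b i) - (-(EuclideanSpace.single τ (1 : ℝ)))‖ ^ (2 * Δ)) *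
        osPointKernel S (cfg b) (cfg a) :=
    fun a b => inversionGram_eq_weight_mul_osPointKernel τ htr hsc hinv hperm hX a b
  refine Matrix.PosSemidef.of_dotProduct_mulVec_nonneg ?_ fun c => ?_
  · refine Matrix.IsHermitian.ext fun a b => ?_
    rw [star_trivial, Matrix.of_apply, Matrix.of_apply, hfac, hfac, osPointKernel_comm hR hperm]
    ring
  · have h0 := hrp m cfg
      (fun a => c a * ((2 : ℝ) ^ (-(k a : ℝ) * Δ) * ∏ i, ‖inversion (-(EuclideanSpace.single τ (1 : ℝ))) (Real.sqrt 2) (X a i) - (-(EuclideanSpace.single τ (1 : ℝ)))‖ ^ (2 * Δ)))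
    simp only [dotProduct, Matrix.mulVec, star_trivial, Matrix.of_apply, Finset.mul_sum]
    rw [Finset.sum_comm]
    refine h0.trans_eq (Finset.sum_congr rfl fun b _ => Finset.sum_congr rfl fun a _ => ?_)
    rw [hfac]
    ring

/-- The same with the OS premises packaged as `PointwiseOSReconstruction τ S` (which carries
reflection positivity, reflection invariance, permutation symmetry and translation invariance).
[cite: LuscherMack1975, §2–§3] -/
theorem isInversionPositive_of_covariant_of_pointwiseOS {Δ : ℝ} {S : CorrFamily d} (τ : Fin d)
    (hos : PointwiseOSReconstruction τ S) (hsc : IsScaleCovariant Δ S)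
    (hinv : IsInversionCovariant Δ S) : IsInversionPositive Δ S :=
  isInversionPositive_of_covariant_of_reflectionPositive τ hos.translationInvariant hsc hinv
    hos.symmetric hos.reflectionInvariant hos.reflectionPositive

end Summit.CriticalPhenomena.Ising3DConformalLimit.MoebiusLimitExistsMackConverse

end
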